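import Summits.QuantumFields.YangMills.Theorems.AlphaInputsT3ACMinimiserPinKnitRec
import HarnessLib

/-!
# `AlphaInputsT3ACRecordWitness` — THE PRIMITIVE-CONSTANTS RECORD IS INHABITED, AND 2′'s DISPLAY MINUS ITS THREE MASS ROWS IS A THEOREM: the constants
# shell of `AlphaInputsT3AC.PinnedPartsT3ACRec L` (exact p-profile, [7] constants in the small-`a₁` regime, `1 ≤ 2B₃`, the three `C68`-rows) HOLDS for every
# block size `L > 1` — so the whole content of 2′ `stub_laneRecordsV3` in the display of `…MinimiserPinKnitRec` is (T) + (D6) + (O″) — lane `pub-balaban3d`, seat alpha-1 (g7)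

Cell `ym3-torus`, route `UnitScaleTilt`, crux 2′ `stub_laneRecordsV3` (stmt-QuantumFields-19936 ∕ -19935).  Every record-parametric display of the lineage
(`AlphaInputsT3ACv3Rec`, `DataSchemaT3ACRec`, `DataPartsT3ACRec`, `AlphaInputsT3AC.PinnedPartsT3ACRec`) has the shell `∃ b₁ p₁ ∀ b₀ p₀ ⪰ ∃ 𝔠 : AlphaConsts L N, …`,
and the constants lemmas of the lineage (`AlphaInputsT3AC.exists_alphaConsts_profile`, `AlphaInputsT3AC.exists_record_sizes`) take a record `𝔠₀` as INPUT; the tree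
had no inhabitant of `Summit.QuantumFields.Balaban3D.Proofs.Primitives.AlphaConsts L N`.  THIS FILE:
* §1 `AlphaInputsT3AC.exists_alphaConsts`: for every `L > 1`, every `N` and every `B₃ > 0` there is a record with `𝔠.B₃ = B₃` (all located structural
  conditions of the record met by explicit numbers: `κ₀ = ¼ < ½`, `R₁ = 7 ≥ 6 + 2κ₀`, `r₀ = 1`, `M₁ = 1`, `κ = κ₀(32,6) + 1`, `C25 = C63 = CM = 0`, …) — a
  NON-VACUITY witness for the record TYPE only (its O(1)'s are not the expansion's; the data rows at such a record are not claimed);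
* §2 `AlphaInputsT3AC.exists_record_sizes'`: hence, with no input record, for all `b₀ ≥ b₁(L, N, B₃, a₁)`, `p₀ ≥ 3` a record with EXACT profile `(b₀, p₀)`,
  prescribed `B₃` and the three `C68`-rows of `…MinimiserPinKnitRec` §1;
* §3 ★ `AlphaInputsT3AC.pinnedPartsT3ACRec_shell`: the CONSTANTS SHELL of `AlphaInputsT3AC.PinnedPartsT3ACRec L` — its text with the three mass rows (T)
  `Thm1GlobalMinAt`, (D6) `AdaptedClassNonemptyT3`, (O″) «data rows for some pinned family» DELETED — is a THEOREM for every `1 < L` (`B₃ := 1`,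
  `a₀ = a₁ := min (1/(6·143·(7²/4)²)) (δ_SU(2)/(2(7L)²))`, `p₁ := 3`).  So the display of 2′ carries no hidden constraint in its constants bookkeeping:
  everything it asks of a supplier is (T) + (D6) + (O″) at a record of the supplier's naming (RIDER R-g17: named WITH the sizes, which §2 shows is free).
HONEST FRAMING.  Kernel facts about the tree's own record type; the witness record is arithmetic, not print's constants; nothing of [Balaban1985UV3] or
[Balaban1985Variational] is asserted or proved; count-neutral; not a claim about d = 4, the continuum limit, or the mass gap.
References: T. Bałaban, Commun. Math. Phys. 102 (1985) 255–275 [Balaban1985UV3], (7) p. 257, p. 262 L3, (25)∕(28) pp. 262–263, (44) p. 267, (68) p. 273;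
Commun. Math. Phys. 102 (1985) 277–309 [Balaban1985Variational], Thm 1 (6)–(8) pp. 278–279.
-/

set_option autoImplicit false

noncomputable section

namespace Summit.QuantumFields.YangMills.Theorems

open Literature.MathematicalPhysics.QuantumFieldTheory.Balaban1983to89
open Literature.MathematicalPhysics.QuantumFieldTheory.Balaban1983to89.B12TreeDecay (kappa₀ K₀ K₀_pos)
open Literature.MathematicalPhysics.QuantumFieldTheory.Balaban1983to89.ExpMeanLog (deltaSU deltaSU_pos)
open Literature.MathematicalPhysics.QuantumFieldTheory.Balaban1985CMP102.Setting
open Summit.QuantumFields.Balaban3D.Carriers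
open Summit.QuantumFields.Balaban3D.Proofs.Primitives
open Summit.QuantumFields.Balaban3D.Proofs.Thresholds (Q0 Q0_pos)
open B7Prop2Explicit (C0 C0_pos)

/-! ## §1 The record type is inhabited -/

/-- **THE PRIMITIVE-CONSTANTS RECORD TYPE IS INHABITED** for every block size `L > 1`, every model size `N` and every prescribed `B₃ > 0`: all located
structural conditions of `AlphaConsts` (`0 < κ₀ < ½`, `M₁ ≥ 1`, `r₀ ≥ 1`, `R₁ ≥ 6 + 2κ₀`, `ρ > 0`, `κ ≥ κ₀(32,6) + 1`, `C25·K₀ ≤ CM`, `C63·K₀ ≤ CM`, `c35, cT > 0`,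
`Ca + Cc ≥ 0`, `B₃, κ₁, C68 > 0`, the non-negativities) are met by explicit numbers.  A witness for the TYPE — its O(1)'s are not the expansion's constants.
[cite: Balaban1985UV3, (7) p.257, p.262 L3, (25) p.262, (28) p.263, (44) p.267, (68) p.273 (the located conditions on the family parameters)] -/
theorem AlphaInputsT3AC.exists_alphaConsts {L : ℕ} (hL : 1 < L) (N : ℕ) {B₃ : ℝ} (hB₃ : 0 < B₃) :
    ∃ 𝔠 : AlphaConsts L N, 𝔠.B₃ = B₃ :=
  ⟨{ κ₀ := 1 / 4
     M₁ := 1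
     r₀ := 1
     R₁ := 7
     logσ₀ := 0
     dimg := 0
     one_lt_L := hL
     κ₀_pos := by norm_num
     κ₀_lt_half := by norm_num
     M₁_pos := Nat.one_pos
     one_le_r₀ := le_rfl
     R₁_ge := by norm_num
     ρ := 1
     cB := 0
     CM := 0
     Cfar := 0
     κ := kappa₀ (4 * 2 ^ 3) (2 * 3) + 1
     C25 := 0
     C63 := 0
     ρ_pos := one_pos
     cB_nonneg := le_rfl
     CM_nonneg := le_rfl
     Cfar_nonneg := le_rfl
     kappa_ge := le_rfl
     C25_nonneg := le_rfl
     C25_le := by simp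
     C63_nonneg := le_rfl
     C63_le := by simp
     c35 := 1
     a35 := 0
     cv := 0
     cJ35 := 0
     cT := 1
     aT := 0
     cn := 0
     cJT := 0
     c35_pos := one_pos
     cv_nonneg := le_rfl
     cJ35_nonneg := le_rfl
     cT_pos := one_pos
     cn_nonneg := le_rfl
     cJT_nonneg := le_rfl
     Ca := 0
     Cc := 0
     nbar := 0
     Cac_nonneg := by norm_num
     B₃ := B₃
     κ₁ := 1
     C44 := 0
     B₃_pos := hB₃
     κ₁_pos := one_pos
     C44_nonneg := le_rfl
     C68 := 1
     C68_pos := one_pos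
     C45 := 0
     C45_nonneg := le_rfl }, rfl⟩

/-- `AlphaConsts L N` is non-empty for `L > 1`. [cite: Balaban1985UV3, (7) p.257 (bookkeeping)] -/
theorem AlphaInputsT3AC.nonempty_alphaConsts {L : ℕ} (hL : 1 < L) (N : ℕ) : Nonempty (AlphaConsts L N) := by
  obtain ⟨𝔠, -⟩ := AlphaInputsT3AC.exists_alphaConsts hL N one_pos
  exact ⟨𝔠⟩

/-! ## §2 Records with exact profile, prescribed `B₃` and the three `C68`-rows — with no input record -/

/-- **RECORDS WITH EXACT PROFILE, PRESCRIBED `B₃` AND ALL THREE `C68`-SIZES EXIST BEYOND A THRESHOLD** — `AlphaInputsT3AC.exists_record_sizes` at the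
witness of §1: for `L > 1`, `B₃ > 0`, `a₁ > 0` there is `b₁ ≥ 0` such that for all `b₀ ≥ b₁`, `p₀ ≥ 3` some record has `𝔠.b₀ = b₀`, `𝔠.p₀ = p₀`, `𝔠.B₃ = B₃`,
`4B₃L²·avgWindowFactor(L) ≤ C68`, `e^{p₀−1} ≤ 3C₀(3)·C68·b₀Q₀(p₀)`, `b₀Q₀(p₀)·(2L²·avgWindowFactor(L))² ≤ 3C₀(3)·C68·a₁²`.
[cite: Balaban1985UV3, (7) p.257 and (68) p.273 (bookkeeping)] -/
theorem AlphaInputsT3AC.exists_record_sizes' {L : ℕ} (hL : 1 < L) (N : ℕ) {B₃ a₁ : ℝ} (hB₃ : 0 < B₃) (ha₁ : 0 < a₁) :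
    ∃ b₁ : ℝ, 0 ≤ b₁ ∧ ∀ (b₀ p₀ : ℝ), b₁ ≤ b₀ → 3 ≤ p₀ →
      ∃ 𝔠 : AlphaConsts L N, 𝔠.b₀ = b₀ ∧ 𝔠.p₀ = p₀ ∧ 𝔠.B₃ = B₃ ∧
        4 * 𝔠.B₃ * (L : ℝ) ^ 2 * avgWindowFactor L ≤ 𝔠.C68 ∧
        Real.exp (𝔠.p₀ - 1) ≤ 3 * C0 3 * 𝔠.C68 * (𝔠.b₀ * Q0 𝔠.p₀) ∧
        (𝔠.b₀ * Q0 𝔠.p₀) * (2 * (L : ℝ) ^ 2 * avgWindowFactor L) ^ 2 ≤ 3 * C0 3 * 𝔠.C68 * a₁ ^ 2 := by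
  obtain ⟨𝔠₀, h𝔠₀⟩ := AlphaInputsT3AC.exists_alphaConsts hL N hB₃
  obtain ⟨b₁, hb₁, h⟩ := AlphaInputsT3AC.exists_record_sizes 𝔠₀ ha₁
  refine ⟨b₁, hb₁, fun b₀ p₀ hb hp => ?_⟩
  obtain ⟨𝔠, h1, h2, h3, h4⟩ := h b₀ p₀ hb hp
  exact ⟨𝔠, h1, h2, h3.trans h𝔠₀, h4⟩

/-! ## §3 ★ The constants shell of 2′'s display is a theorem -/

/-- The [7] constant `a₁(L) := min (1/(6·143·(7²/4)²)) (δ_SU(2)/(2(7L)²))` is positive. [cite: Balaban1985Variational, Thm 1 p.279 («a₁ sufficiently small»)] -/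
theorem AlphaInputsT3AC.a₁Witness_pos (L : ℕ) (hL : 1 < L) :
    0 < min (1 / (6 * (143 * ((((3 + 4 : ℕ) : ℝ)) ^ 2 / 4) ^ 2))) (deltaSU (Fin 2) / (2 * (((3 + 4) * L : ℕ) : ℝ) ^ 2)) := by
  have hδ : 0 < deltaSU (Fin 2) := deltaSU_pos
  have h7L : (0 : ℝ) < (((3 + 4) * L : ℕ) : ℝ) := by
    have : 0 < (3 + 4) * L := by omega
    exact_mod_cast this
  refine lt_min (by positivity) (by positivity)

/-- ★ **THE CONSTANTS SHELL OF `AlphaInputsT3AC.PinnedPartsT3ACRec L` HOLDS** for every block size `L > 1`: thresholds `b₁, p₁ := 3` such that for every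
profile beyond them there is a record with EXACTLY that p-function and [7] constants `a₀ = a₁ > 0` with `B₃a₁ ≤ a₀`, the small-`a₁` rows
(`143·(7²/4)²·2B₃a₁ ≤ ⅓`, `4B₃a₁ ≤ 2δ_SU(2)/(7L)²`), `1 ≤ 2B₃` (`B₃ := 1`) and the three `C68`-rows — i.e. the display of 2′ in `…MinimiserPinKnitRec` with its
three mass rows (T) `Thm1GlobalMinAt`, (D6) `AdaptedClassNonemptyT3`, (O″) «data rows for some pinned family» deleted.  CERTIFICATE that the display's
constants bookkeeping is consistent and free; all content of 2′ is (T) + (D6) + (O″).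
[cite: Balaban1985UV3, (7) p.257, (40) p.266 and (68) p.273 (bookkeeping); Balaban1985Variational, Thm 1 (6)–(8) pp.278–279 (constants regime)] -/
theorem AlphaInputsT3AC.pinnedPartsT3ACRec_shell {L : ℕ} (hL : 1 < L) (N : ℕ) :
    ∃ (b₁ p₁ : ℝ), ∀ (b₀ p₀ : ℝ), b₁ ≤ b₀ → p₁ ≤ p₀ →
      ∃ (𝔠 : AlphaConsts L N) (a₀ a₁ : ℝ), 𝔠.b₀ = b₀ ∧ 𝔠.p₀ = p₀ ∧ 0 < a₀ ∧ 0 < a₁ ∧ 𝔠.B₃ * a₁ ≤ a₀ ∧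
        (143 * ((((3 + 4 : ℕ) : ℝ)) ^ 2 / 4) ^ 2) * (2 * (𝔠.B₃ * a₁)) ≤ 1 / 3 ∧
        2 * (2 * (𝔠.B₃ * a₁)) ≤ 2 * deltaSU (Fin 2) / (((3 + 4) * L : ℕ) : ℝ) ^ 2 ∧
        1 ≤ 2 * 𝔠.B₃ ∧ 4 * 𝔠.B₃ * (L : ℝ) ^ 2 * avgWindowFactor L ≤ 𝔠.C68 ∧
        Real.exp (𝔠.p₀ - 1) ≤ 3 * C0 3 * 𝔠.C68 * (𝔠.b₀ * Q0 𝔠.p₀) ∧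
        (𝔠.b₀ * Q0 𝔠.p₀) * (2 * (L : ℝ) ^ 2 * avgWindowFactor L) ^ 2 ≤ 3 * C0 3 * 𝔠.C68 * a₁ ^ 2 := by
  -- the [7] constant `a₁(L)` and `B₃ := 1`
  set a₁ : ℝ := min (1 / (6 * (143 * ((((3 + 4 : ℕ) : ℝ)) ^ 2 / 4) ^ 2))) (deltaSU (Fin 2) / (2 * (((3 + 4) * L : ℕ) : ℝ) ^ 2))
    with ha₁_def
  have ha₁ : 0 < a₁ := AlphaInputsT3AC.a₁Witness_pos L hL
  have hK : (0 : ℝ) < 143 * ((((3 + 4 : ℕ) : ℝ)) ^ 2 / 4) ^ 2 := by positivity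
  have h7L : (0 : ℝ) < (((3 + 4) * L : ℕ) : ℝ) ^ 2 := by
    have : 0 < (3 + 4) * L := by omega
    have h : (0 : ℝ) < (((3 + 4) * L : ℕ) : ℝ) := by exact_mod_cast this
    positivity
  obtain ⟨b₁, -, h⟩ := AlphaInputsT3AC.exists_record_sizes' hL N one_pos ha₁
  refine ⟨b₁, 3, fun b₀ p₀ hb hp => ?_⟩
  obtain ⟨𝔠, h1, h2, hB, s1, s2, s3⟩ := h b₀ p₀ hb hp
  refine ⟨𝔠, a₁, a₁, h1, h2, ha₁, ha₁, by rw [hB, one_mul], ?_, ?_, by rw [hB]; norm_num, s1, s2, s3⟩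
  · -- `143·(7²/4)²·(2·a₁) ≤ ⅓` from `a₁ ≤ 1/(6·143·(7²/4)²)`
    rw [hB, one_mul]
    have hle : a₁ ≤ 1 / (6 * (143 * ((((3 + 4 : ℕ) : ℝ)) ^ 2 / 4) ^ 2)) := min_le_left _ _
    calc 143 * ((((3 + 4 : ℕ) : ℝ)) ^ 2 / 4) ^ 2 * (2 * a₁)
        ≤ 143 * ((((3 + 4 : ℕ) : ℝ)) ^ 2 / 4) ^ 2 * (2 * (1 / (6 * (143 * ((((3 + 4 : ℕ) : ℝ)) ^ 2 / 4) ^ 2)))) := by gcongr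
      _ = 1 / 3 := by field_simp; ring
  · -- `2·(2·a₁) ≤ 2δ/(7L)²` from `a₁ ≤ δ/(2(7L)²)`
    rw [hB, one_mul]
    have hle : a₁ ≤ deltaSU (Fin 2) / (2 * (((3 + 4) * L : ℕ) : ℝ) ^ 2) := min_le_right _ _
    calc 2 * (2 * a₁) ≤ 2 * (2 * (deltaSU (Fin 2) / (2 * (((3 + 4) * L : ℕ) : ℝ) ^ 2))) := by gcongr
      _ = 2 * deltaSU (Fin 2) / (((3 + 4) * L : ℕ) : ℝ) ^ 2 := by field_simp

/-- **IN PARTICULAR FOR THE LANE's MODEL `SU(2) ⊂ U((suGroupModel 2).N)`**: the constants shell of 2′'s display `AlphaInputsT3AC.PinnedPartsT3ACRec L` holds at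
the record type the registered text quantifies over. [cite: Balaban1985UV3, (7) p.257 (bookkeeping)] -/
theorem AlphaInputsT3AC.pinnedPartsT3ACRec_shell_su2 {L : ℕ} (hL : 1 < L) :
    ∃ (b₁ p₁ : ℝ), ∀ (b₀ p₀ : ℝ), b₁ ≤ b₀ → p₁ ≤ p₀ →
      ∃ (𝔠 : AlphaConsts L (suGroupModel 2).N) (a₀ a₁ : ℝ), 𝔠.b₀ = b₀ ∧ 𝔠.p₀ = p₀ ∧ 0 < a₀ ∧ 0 < a₁ ∧ 𝔠.B₃ * a₁ ≤ a₀ ∧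
        (143 * ((((3 + 4 : ℕ) : ℝ)) ^ 2 / 4) ^ 2) * (2 * (𝔠.B₃ * a₁)) ≤ 1 / 3 ∧
        2 * (2 * (𝔠.B₃ * a₁)) ≤ 2 * deltaSU (Fin 2) / (((3 + 4) * L : ℕ) : ℝ) ^ 2 ∧
        1 ≤ 2 * 𝔠.B₃ ∧ 4 * 𝔠.B₃ * (L : ℝ) ^ 2 * avgWindowFactor L ≤ 𝔠.C68 ∧
        Real.exp (𝔠.p₀ - 1) ≤ 3 * C0 3 * 𝔠.C68 * (𝔠.b₀ * Q0 𝔠.p₀) ∧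
        (𝔠.b₀ * Q0 𝔠.p₀) * (2 * (L : ℝ) ^ 2 * avgWindowFactor L) ^ 2 ≤ 3 * C0 3 * 𝔠.C68 * a₁ ^ 2 :=
  AlphaInputsT3AC.pinnedPartsT3ACRec_shell hL _

end Summit.QuantumFields.YangMills.Theorems

end
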